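import Summits.BirchSwinnertonDyer.BirchSwinnertonDyer.Theorems.ManinLocalTwoThreeHeisenbergLift
import Literature.NumberTheory.ModularForms.Gamma0FreeModNegOneProofs
import Mathlib.GroupTheory.FreeGroup.Basic
import HarnessLib

/-!
# The HEISENBERG LIFT modulo ANY `p` on `Γ₀(M)` from a free presentation of `Γ₀(M)/{±1}` — the prime-generic core of the `K_{p,p}` steps
# (route `ManinLocalTwoThree`, cell bsd-f2-manin; cruxes C2 stmt-22967 / C3 stmt-22968; LEAD seat p1 gen 11; for the 2-ADIC TWIN A-p3-1 and the
# prime-generic shift-equaliser conjecture of HOME/p1/CENSUS-shift-equaliser-p1-g11.md)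

`…HeisenbergLift.lean` (p682382) is `ℤ/3`-valued throughout (`IsAddChar`).  This sibling repeats its §1–§2 over `ZMod p` for an ARBITRARY
`p : ℕ`, with additivity spelled out and the ONE place where `p = 3` mattered made explicit: an additive character kills `−1` only when
`2 ≠ 0` in `ℤ/p` (`map_negOne_eq_zero_of_two_ne_zero`, `two_ne_zero_of_odd_prime`); at `p = 2` the vanishing `β(−1) = λ(−1) = 0` is a
HYPOTHESIS of **`exists_heisenbergLift`** (satisfied by the characters `β = ab`, `λ = a·c/(p^k M)` of the descent, which vanish on `−I`).
INPUT SHAPE = the tree's theorems `gamma0_eq_negOne_prod_free_of_nine_dvd_holds` / `_of_four_dvd` / `_of_trace_ne` (p2 g12, Literature):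
`Γ₀(M) = {±1} × e(FreeGroup ι)`.  OUTPUT: `μ : Γ₀(M) → ℤ/p` with `μ(γγ') = μ γ + μ γ' + β γ · λ γ'`, plus the corollaries
`exists_heisenbergLift_of_four_dvd` (p = 2 twin input: every `4 ∣ M`) and `exists_heisenbergLift_of_nine_dvd` (any `p`, `9 ∣ M`).
HONEST FRAMING: group theory only; nothing about C2/C3, Manin's conjecture or BSD is proved.  No Prop-valued definitions, no sorry.
[cite: Kulkarni1991, Thm. 3.2 and Thm. 3.3 (shape of the input)] [cite: DarmonDiamondTaylor1995, Lemma 4.28 (p. 135)]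
-/

set_option autoImplicit false
set_option linter.dupNamespace false

open scoped MatrixGroups

open CongruenceSubgroup Matrix.SpecialLinearGroup
open Literature.NumberTheory.ModularForms (gamma0_eq_negOne_prod_free_of_four_dvd gamma0_eq_negOne_prod_free_of_nine_dvd_holds)
open Summit.BirchSwinnertonDyer.BirchSwinnertonDyer.Theorems.ManinLocalTwoThree.ThreeShiftDescent
  (negOne_mem_Gamma0 sgn sgn_mul_comm sgn_mul_sgn sgn_mem eG eG_mul eG_one eG_inv coord coord_spec coord_unique coord_mul)

namespace Summit.BirchSwinnertonDyer.BirchSwinnertonDyer.Theorems.ManinLocalTwoThree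

namespace ShiftDescentModP

/-! ### §1. Unitriangular `3 × 3` matrices over `𝔽_p` (the Heisenberg group of order `p³`) -/

section Heisenberg

variable (p : ℕ)

/-- The unitriangular matrix `U(x, y, z) = (1 x z; 0 1 y; 0 0 1) ∈ SL₃(𝔽_p)`. [folklore] -/
def heisU (p : ℕ) (x y z : ZMod p) : SL(3, ZMod p) :=
  ⟨!![1, x, z; 0, 1, y; 0, 0, 1], by simp [Matrix.det_fin_three]⟩

/-- Heisenberg multiplication: `U(x,y,z) U(x',y',z') = U(x+x', y+y', z+z'+x y')`. [folklore] -/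
theorem heisU_mul (x y z x' y' z' : ZMod p) :
    heisU p x y z * heisU p x' y' z' = heisU p (x + x') (y + y') (z + z' + x * y') := by
  apply Subtype.ext
  simp only [heisU, Matrix.SpecialLinearGroup.coe_mul]
  ext i j
  fin_cases i <;> fin_cases j <;> simp [Matrix.mul_apply, Fin.sum_univ_three] <;> ring

/-- `U(0,0,0) = 1`. [folklore] -/
theorem heisU_zero : heisU p 0 0 0 = 1 := by
  apply Subtype.ext
  simp only [heisU, Matrix.SpecialLinearGroup.coe_one]
  ext i j
  fin_cases i <;> fin_cases j <;> simp

/-- `U(x,y,z)⁻¹ = U(−x, −y, x y − z)`. [folklore] -/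
theorem heisU_inv (x y z : ZMod p) : (heisU p x y z)⁻¹ = heisU p (-x) (-y) (x * y - z) := by
  rw [inv_eq_iff_mul_eq_one, heisU_mul, ← heisU_zero]
  congr 1 <;> ring

/-- The `(0,2)` entry of `U(x,y,z)` is `z`. [folklore] -/
theorem heisU_apply_02 (x y z : ZMod p) : (heisU p x y z) 0 2 = z := rfl

end Heisenberg

/-! ### §2. The Heisenberg lift from a free presentation modulo `±1` -/

section Lift

variable {p : ℕ} {M : ℕ}

/-- An additive `𝔽_p`-character of `Γ₀(M)` kills `1`. [folklore] -/
theorem isAddChar_map_one {φ : Gamma0 M → ZMod p} (hφ : ∀ x y : Gamma0 M, φ (x * y) = φ x + φ y) : φ 1 = 0 := by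
  have h := hφ 1 1; rw [mul_one] at h
  have h2 : φ 1 + φ 1 = φ 1 + 0 := by rw [add_zero]; exact h.symm
  exact add_left_cancel h2

/-- An additive `𝔽_p`-character of `Γ₀(M)` is odd. [folklore] -/
theorem isAddChar_map_inv {φ : Gamma0 M → ZMod p} (hφ : ∀ x y : Gamma0 M, φ (x * y) = φ x + φ y) (γ : Gamma0 M) : φ γ⁻¹ = -φ γ := by
  have h := hφ γ γ⁻¹
  rw [mul_inv_cancel, isAddChar_map_one hφ] at h
  exact eq_neg_of_add_eq_zero_right h.symm

/-- An additive `𝔽_p`-character of `Γ₀(M)` kills `−1` as soon as `2 ≠ 0` in `ℤ/p` (`2 φ(−1) = φ(1) = 0`); for `p = 2`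
this can FAIL and is taken as a hypothesis below. [folklore] -/
theorem map_negOne_eq_zero_of_two_ne_zero [Fact p.Prime] {φ : Gamma0 M → ZMod p}
    (hφ : ∀ x y : Gamma0 M, φ (x * y) = φ x + φ y) (h2 : (2 : ZMod p) ≠ 0) :
    φ ⟨-1, negOne_mem_Gamma0⟩ = 0 := by
  have h := hφ ⟨-1, negOne_mem_Gamma0⟩ ⟨-1, negOne_mem_Gamma0⟩
  have e : (⟨-1, negOne_mem_Gamma0⟩ * ⟨-1, negOne_mem_Gamma0⟩ : Gamma0 M) = 1 := Subtype.ext (by simp)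
  rw [e, isAddChar_map_one hφ] at h
  have h' : (2 : ZMod p) * φ ⟨-1, negOne_mem_Gamma0⟩ = 0 := by rw [two_mul]; exact h.symm
  rcases mul_eq_zero.mp h' with h0 | h0
  · exact absurd h0 h2
  · exact h0

/-- `2 ≠ 0` in `ℤ/p` for an odd prime `p`. [folklore] -/
theorem two_ne_zero_of_odd_prime [hp : Fact p.Prime] (hp2 : p ≠ 2) : (2 : ZMod p) ≠ 0 := by
  intro h
  have h' : ((2 : ℕ) : ZMod p) = 0 := by exact_mod_cast h
  rw [ZMod.natCast_eq_zero_iff] at h'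
  have := (Nat.prime_dvd_prime_iff_eq hp.out Nat.prime_two).mp h'
  exact hp2 this

/-- An additive `𝔽_p`-character VANISHING AT `−1` kills `sgn b`. [folklore] -/
theorem map_sgn_eq_zero {φ : Gamma0 M → ZMod p} (hφ : ∀ x y : Gamma0 M, φ (x * y) = φ x + φ y)
    (hneg : φ ⟨-1, negOne_mem_Gamma0⟩ = 0) (b : Bool) : φ ⟨sgn b, sgn_mem b⟩ = 0 := by
  cases b
  · have e : (⟨sgn false, sgn_mem false⟩ : Gamma0 M) = 1 := Subtype.ext (by simp [sgn])
    rw [e, isAddChar_map_one hφ]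
  · have e : (⟨sgn true, sgn_mem true⟩ : Gamma0 M) = ⟨-1, negOne_mem_Gamma0⟩ := Subtype.ext (by simp [sgn])
    rw [e, hneg]

variable {ι : Type} {e : FreeGroup ι →* SL(2, ℤ)}

variable (β lam : Gamma0 M → ZMod p)

/-- The Heisenberg representation `θ : FreeGroup ι →* SL₃(𝔽_p)`, generator `i ↦ U(β(e i), λ(e i), 0)`. [folklore] -/
noncomputable def theta (himg : ∀ w : FreeGroup ι, e w ∈ Gamma0 M) : FreeGroup ι →* SL(3, ZMod p) :=
  FreeGroup.lift fun i => heisU p (β (eG himg (FreeGroup.of i))) (lam (eG himg (FreeGroup.of i))) 0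

/-- **`θ(w)` is unitriangular with off-diagonal `β(e w)`, `λ(e w)`**: `θ(w) = U(β(e w), λ(e w), z)` for some `z`
(induction on `w`; additivity of `β`, `λ`). [folklore] -/
theorem theta_eq (himg : ∀ w : FreeGroup ι, e w ∈ Gamma0 M) (hβ : ∀ x y : Gamma0 M, β (x * y) = β x + β y) (hlam : ∀ x y : Gamma0 M, lam (x * y) = lam x + lam y)
    (w : FreeGroup ι) : ∃ z : ZMod p, theta β lam himg w = heisU p (β (eG himg w)) (lam (eG himg w)) z := by
  induction w using FreeGroup.induction_on with
  | C1 => exact ⟨0, by rw [map_one, eG_one, isAddChar_map_one hβ, isAddChar_map_one hlam, heisU_zero]⟩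
  | of i => exact ⟨0, by simp [theta]⟩
  | inv_of i ih =>
      obtain ⟨z, hz⟩ := ih
      refine ⟨β (eG himg (FreeGroup.of i)) * lam (eG himg (FreeGroup.of i)) - z, ?_⟩
      rw [map_inv, hz, heisU_inv, eG_inv, isAddChar_map_inv hβ, isAddChar_map_inv hlam]
  | mul x y hx hy =>
      obtain ⟨zx, hzx⟩ := hx
      obtain ⟨zy, hzy⟩ := hy
      refine ⟨zx + zy + β (eG himg x) * lam (eG himg y), ?_⟩
      rw [map_mul, hzx, hzy, heisU_mul, eG_mul, hβ, hlam]

/-- The central coordinate `z(w) := θ(w)₀₂`. [folklore] -/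
noncomputable def zc (himg : ∀ w : FreeGroup ι, e w ∈ Gamma0 M) (w : FreeGroup ι) : ZMod p :=
  (theta β lam himg w) 0 2

/-- `θ(w) = U(β(e w), λ(e w), z(w))`. [folklore] -/
theorem theta_eq_heisU (himg : ∀ w : FreeGroup ι, e w ∈ Gamma0 M) (hβ : ∀ x y : Gamma0 M, β (x * y) = β x + β y) (hlam : ∀ x y : Gamma0 M, lam (x * y) = lam x + lam y)
    (w : FreeGroup ι) : theta β lam himg w = heisU p (β (eG himg w)) (lam (eG himg w)) (zc β lam himg w) := by
  obtain ⟨z, hz⟩ := theta_eq β lam himg hβ hlam w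
  rw [zc, hz, heisU_apply_02]

/-- **The Heisenberg cocycle identity on the free group**: `z(w w') = z(w) + z(w') + β(e w) λ(e w')`. [folklore] -/
theorem zc_mul (himg : ∀ w : FreeGroup ι, e w ∈ Gamma0 M) (hβ : ∀ x y : Gamma0 M, β (x * y) = β x + β y) (hlam : ∀ x y : Gamma0 M, lam (x * y) = lam x + lam y)
    (w w' : FreeGroup ι) :
    zc β lam himg (w * w') = zc β lam himg w + zc β lam himg w' + β (eG himg w) * lam (eG himg w') := by
  have h := theta_eq_heisU β lam himg hβ hlam (w * w')
  rw [map_mul, theta_eq_heisU β lam himg hβ hlam w, theta_eq_heisU β lam himg hβ hlam w', heisU_mul] at h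
  have := congrArg (fun g : SL(3, ZMod p) => g 0 2) h
  simp only [heisU_apply_02] at this
  exact this.symm

variable (huniq : ∀ γ : SL(2, ℤ), γ ∈ Gamma0 M →
  ∃! p : FreeGroup ι × Bool, γ = (if p.2 then (-1 : SL(2, ℤ)) else 1) * e p.1)

/-- `β(γ) = β(e(coord γ))` (the sign is killed by `β`). [folklore] -/
theorem apply_eq_apply_eG_coord (hβ : ∀ x y : Gamma0 M, β (x * y) = β x + β y)
    (hβneg : β ⟨-1, negOne_mem_Gamma0⟩ = 0) (himg : ∀ w : FreeGroup ι, e w ∈ Gamma0 M) (γ : Gamma0 M) :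
    β γ = β (eG himg (coord huniq γ).1) := by
  have e1 : γ = ⟨sgn (coord huniq γ).2, sgn_mem _⟩ * eG himg (coord huniq γ).1 :=
    Subtype.ext (by rw [coord_spec huniq γ]; rfl)
  rw [e1, hβ, map_sgn_eq_zero hβ hβneg, zero_add, ← e1]

/-- **THE HEISENBERG LIFT (from E-es-108's shape at one level).**  If every `γ ∈ Γ₀(M)` is `± e(w)` for a unique
`(w, ±)`, `e : FreeGroup ι →* SL₂(ℤ)` with image in `Γ₀(M)`, then for every pair of additive characters
`β, λ : Γ₀(M) → 𝔽_p` there is `μ : Γ₀(M) → 𝔽_p` with `μ(γγ') = μ(γ) + μ(γ') + β(γ)λ(γ')` — a homomorphism to the Heisenberg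
group lifting `(β, λ)`; equivalently `β ∪ λ = 0` in `H²(Γ₀(M); 𝔽_p)`. [folklore] -/
theorem exists_heisenbergLift (himg : ∀ w : FreeGroup ι, e w ∈ Gamma0 M)
    (huniq : ∀ γ : SL(2, ℤ), γ ∈ Gamma0 M →
      ∃! p : FreeGroup ι × Bool, γ = (if p.2 then (-1 : SL(2, ℤ)) else 1) * e p.1)
    (hβ : ∀ x y : Gamma0 M, β (x * y) = β x + β y) (hlam : ∀ x y : Gamma0 M, lam (x * y) = lam x + lam y)
    (hβneg : β ⟨-1, negOne_mem_Gamma0⟩ = 0) (hlamneg : lam ⟨-1, negOne_mem_Gamma0⟩ = 0) :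
    ∃ μ : Gamma0 M → ZMod p, ∀ γ γ' : Gamma0 M, μ (γ * γ') = μ γ + μ γ' + β γ * lam γ' := by
  refine ⟨fun γ => zc β lam himg (coord huniq γ).1, fun γ γ' => ?_⟩
  simp only
  rw [coord_mul, zc_mul β lam himg hβ hlam, ← apply_eq_apply_eG_coord β huniq hβ hβneg himg γ,
    ← apply_eq_apply_eG_coord lam huniq hlam hlamneg himg γ']


/-- **p = 2 twin input (and any `p`)**: at every level `4 ∣ M` the Heisenberg lift exists for additive `β, λ : Γ₀(M) → ℤ/p` vanishing at `−1`
(free presentation from p2's `gamma0_eq_negOne_prod_free_of_four_dvd`). [cite: Kulkarni1991, Thm. 3.2 and Thm. 3.3 (shape)] -/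
theorem exists_heisenbergLift_of_four_dvd (h4 : 4 ∣ M) (β lam : Gamma0 M → ZMod p)
    (hβ : ∀ x y : Gamma0 M, β (x * y) = β x + β y) (hlam : ∀ x y : Gamma0 M, lam (x * y) = lam x + lam y)
    (hβneg : β ⟨-1, negOne_mem_Gamma0⟩ = 0) (hlamneg : lam ⟨-1, negOne_mem_Gamma0⟩ = 0) :
    ∃ μ : Gamma0 M → ZMod p, ∀ γ γ' : Gamma0 M, μ (γ * γ') = μ γ + μ γ' + β γ * lam γ' := by
  obtain ⟨ι, e, himg, huniq⟩ := gamma0_eq_negOne_prod_free_of_four_dvd M h4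
  exact exists_heisenbergLift β lam himg huniq hβ hlam hβneg hlamneg

/-- **Any `p`, level `9 ∣ M`** (free presentation from `gamma0_eq_negOne_prod_free_of_nine_dvd_holds`). [cite: Kulkarni1991, Thm. 3.2 and Thm. 3.3 (shape)] -/
theorem exists_heisenbergLift_of_nine_dvd (h9 : 9 ∣ M) (β lam : Gamma0 M → ZMod p)
    (hβ : ∀ x y : Gamma0 M, β (x * y) = β x + β y) (hlam : ∀ x y : Gamma0 M, lam (x * y) = lam x + lam y)
    (hβneg : β ⟨-1, negOne_mem_Gamma0⟩ = 0) (hlamneg : lam ⟨-1, negOne_mem_Gamma0⟩ = 0) :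
    ∃ μ : Gamma0 M → ZMod p, ∀ γ γ' : Gamma0 M, μ (γ * γ') = μ γ + μ γ' + β γ * lam γ' := by
  obtain ⟨ι, e, himg, huniq⟩ := gamma0_eq_negOne_prod_free_of_nine_dvd_holds M h9
  exact exists_heisenbergLift β lam himg huniq hβ hlam hβneg hlamneg

end Lift

end ShiftDescentModP

end Summit.BirchSwinnertonDyer.BirchSwinnertonDyer.Theorems.ManinLocalTwoThree
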